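/-
Copyright (c) 2026. All rights reserved.
Released under Apache 2.0 license as described in the file LICENSE.
Authors: abc-iut cell, prover seat abc-iut-w5-d096 (gen 8; [AbsTopIII] Cor 2.4 (c) — the hyperbolic-core
orbispace `[𝕌/Π]` as a TERM of `AutHolOrbiPresentation`, assembling abc-iut-L4-t8's `HyperbolicCoreOrbispace_holds`
and abc-iut-L4-t7's `mdifferentiable_of_mem_of_coe_eq_autIdComponent`).
-/
import Literature.AnabelianGeometry.AbsoluteAnabelian.HolomorphicCoresProofs
import Literature.AnabelianGeometry.AbsoluteAnabelian.AutHolDiscIdComponentHolomorphicProofs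
import HarnessLib

/-!
# [AbsTopIII] Cor 2.4 (c): the Aut-holomorphic orbispace `𝕏 → ℍ = [𝕌/Π]` of the hyperbolic core, as a term

S. Mochizuki, *Topics in absolute anabelian geometry III*, Cor 2.4 (c) (kurims p.55 l.2–10): «If `𝕏` is not arithmetic,
then the Aut-holomorphic orbispace `𝕏 → ℍ` associated to the hyperbolic core `ℍ` of `𝕏` may be constructed by forming the
"orbispace quotient" of `U^top` by `Π` and equipping this quotient with the pre-Aut-holomorphic structure … determined by
restricting the Aut-holomorphic structure of `𝕌`»; Rmk 2.1.1 p.52 (Aut-holomorphic orbispaces via presentations `[𝕌/Γ]`,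
the tree's `AutHolOrbiPresentation`: a Riemann surface `U`, a group `Γ` acting PROPERLY DISCONTINUOUSLY with FINITE
stabilisers by HOLOMORPHIC automorphisms).

The named fact `HyperbolicCoreOrbispace` of `HolomorphicCores.lean` (typer abc-iut-L4-t2 / abc-iut-L4-t14) records the
three DATA of this presentation for `Γ := Π`, the commensurator of `π₁(X^top) = Aut(U^top/X^top)` in `G = Aut⁰(𝕌)`, and is
PROVED (`HyperbolicCoreOrbispace_holds`, abc-iut-L4-t8); abc-iut-L4-t7's `AutHolDiscIdComponentHolomorphicProofs` proves
that `Aut⁰(𝕌)` consists of BIHOLOMORPHIC maps, so `Π` acts holomorphically on the nose.  This DEF-bearing file packages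
the two into the term print names:

* `coreGroup p G` — the commensurator `Π ≤ Aut(U^top)` of the deck group of `p` in `G` (an abbreviation of the
  expression inside `HyperbolicCoreOrbispace`);
* `hyperbolicCorePresentation … : AutHolOrbiPresentation` — **the orbispace `[𝕌/Π]`** at exactly the binders of
  `HyperbolicCoreOrbispace` (a hyperbolic Riemann surface `X` of finite type, its holomorphic universal covering
  `p : U → X` by an Aut-holomorphic disc, `G` with carrier `Aut⁰(𝕌)`, and print's antecedent «`𝕏` not arithmetic»
  as `IsMargulisNonArithmetic G (deckGroup p)`);
* `hyperbolicCorePresentation_U / _Γ / _smul / _str` — it IS `(U^top, Π)` with `Π` acting tautologically and the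
  Aut-holomorphic structure of `𝕌` (the «restriction» clause: `AutHolOrbiPresentation.str = ofCharted U`).

No new `Prop`, no instance beyond the structure's own fields, no sorry.  Refereed pre-IUT material; nothing here bears on
the disputed [IUTchIII] Cor. 3.12; no side taken.  The quotient SPACE `U^top/Π` with its orbi-structure is, as everywhere
in the tree (Rmk 2.1.1 typing), represented by the presentation itself.
-/

noncomputable section

namespace Literature.AnabelianGeometry.AbsoluteAnabelian

open _root_.TopologicalSpace _root_.Topology _root_.Set _root_.Function _root_.Filter
open scoped _root_.Manifold _root_.ContDiff _root_.Pointwise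

section Core

variable {X : Type} {Ucov : Type} [TopologicalSpace Ucov]

/-- **`Π`**: the commensurator in `G` of the image of `π₁(X^top) = Aut(U^top/X^top)` (Cor 2.4 (c): «its commensurator
`Π ⊆ Aut⁰(𝕌)`»), as a subgroup of `Aut(U^top)` — the expression bound by `let Pc := …` in `HyperbolicCoreOrbispace`.
[cite: MochizukiAbsTopIII2015, Corollary 2.4 (c) p.54] -/
abbrev coreGroup (p : Ucov → X) (G : Subgroup (Ucov ≃ₜ Ucov)) : Subgroup (Ucov ≃ₜ Ucov) :=
  (Subgroup.Commensurable.commensurator ((deckGroup p).subgroupOf G)).map G.subtype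

/-- Elements of `Π` lie in `G`. [cite: MochizukiAbsTopIII2015, Corollary 2.4 (c) p.54] -/
theorem mem_of_mem_coreGroup {p : Ucov → X} {G : Subgroup (Ucov ≃ₜ Ucov)} {γ : Ucov ≃ₜ Ucov}
    (hγ : γ ∈ coreGroup p G) : γ ∈ G := by
  obtain ⟨g, -, rfl⟩ := Subgroup.mem_map.mp hγ
  exact g.2

/-- The tautological action `γ • x := γ x` of a subgroup of `Aut(U^top)` on `U^top` (used as the `act` field of the
presentation; a definition, not an instance). [cite: MochizukiAbsTopIII2015, Remark 2.1.1 p.52] -/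
@[reducible] def subgroupHomeoAction (S : Subgroup (Ucov ≃ₜ Ucov)) : MulAction S Ucov where
  smul γ x := (γ : Ucov ≃ₜ Ucov) x
  one_smul _ := rfl
  mul_smul _ _ _ := rfl

end Core

section Presentation

variable (X : Type) [TopologicalSpace X] [T2Space X] [ChartedSpace ℂ X] [IsManifold 𝓘(ℂ, ℂ) ω X]
  (Ucov : Type) [TopologicalSpace Ucov] [T2Space Ucov] [SimplyConnectedSpace Ucov] [ChartedSpace ℂ Ucov]
  [IsManifold 𝓘(ℂ, ℂ) ω Ucov]

/-- **[AbsTopIII] Cor 2.4 (c): the Aut-holomorphic orbispace `ℍ = [𝕌/Π]` of the hyperbolic core, AS A TERM.**  For a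
hyperbolic Riemann surface `X` of finite type (`IsOfFiniteType X`) with holomorphic universal covering `p : U → X` by an
Aut-holomorphic disc `𝕌`, `G ≤ Aut(U^top)` the subgroup with carrier `Aut⁰(𝕌)`, and `X` not arithmetic in print's sense
(c) (`IsMargulisNonArithmetic G (deckGroup p)`: the deck group has finite index in its commensurator `Π` in `G`): the
presentation `(U, Π)` — `Π` acting tautologically on `U^top` — IS an Aut-holomorphic orbispace presentation: the action is
properly discontinuous with finite stabilisers (`HyperbolicCoreOrbispace_holds`, abc-iut-L4-t8) and by HOLOMORPHIC
automorphisms (`Π ≤ G = Aut⁰(𝕌)` is biholomorphic: abc-iut-L4-t7's `mdifferentiable_of_mem_of_coe_eq_autIdComponent`).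
[cite: MochizukiAbsTopIII2015, Corollary 2.4 (c) p.55] [cite: MochizukiAbsTopIII2015, Remark 2.1.1 p.52] -/
def hyperbolicCorePresentation (p : Ucov → X) (hX : IsOfFiniteType X) (hp : IsCoveringMap p)
    (hs : Function.Surjective p) (hd : MDifferentiable 𝓘(ℂ, ℂ) 𝓘(ℂ, ℂ) p) (hU : IsAutHolDisc Ucov)
    (G : Subgroup (Ucov ≃ₜ Ucov)) (hG : (G : Set (Ucov ≃ₜ Ucov)) = autIdComponent (AutHolStructure.ofCharted Ucov))
    (hna : IsMargulisNonArithmetic G (deckGroup p)) : AutHolOrbiPresentation.{0} where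
  U := Ucov
  Γ := coreGroup p G
  act := subgroupHomeoAction (coreGroup p G)
  properlyDiscontinuous := by
    letI : MulAction (coreGroup p G) Ucov := subgroupHomeoAction (coreGroup p G)
    refine ⟨fun {K L} hK hL => ?_⟩
    have h := (HyperbolicCoreOrbispace_holds X Ucov p hX hp hs hd hU G hG hna).1 K L hK hL
    refine (h.preimage Subtype.val_injective.injOn).subset ?_
    intro γ hγ
    exact ⟨γ.2, hγ⟩
  finite_stabilizer x := by
    letI : MulAction (coreGroup p G) Ucov := subgroupHomeoAction (coreGroup p G)
    have h := (HyperbolicCoreOrbispace_holds X Ucov p hX hp hs hd hU G hG hna).2.1 x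
    refine (h.preimage Subtype.val_injective.injOn).subset ?_
    intro γ hγ
    exact ⟨γ.2, hγ⟩
  isHolAt_smul γ x :=
    Filter.Eventually.of_forall fun y =>
      (mdifferentiable_of_mem_of_coe_eq_autIdComponent hU hG (mem_of_mem_coreGroup γ.2)).1 y
  continuous_smul γ := (γ : Ucov ≃ₜ Ucov).continuous

variable {X Ucov}
variable (p : Ucov → X) (hX : IsOfFiniteType X) (hp : IsCoveringMap p) (hs : Function.Surjective p)
  (hd : MDifferentiable 𝓘(ℂ, ℂ) 𝓘(ℂ, ℂ) p) (hU : IsAutHolDisc Ucov) (G : Subgroup (Ucov ≃ₜ Ucov))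
  (hG : (G : Set (Ucov ≃ₜ Ucov)) = autIdComponent (AutHolStructure.ofCharted Ucov))
  (hna : IsMargulisNonArithmetic G (deckGroup p))

/-- The presenting Riemann surface of `[𝕌/Π]` is `U^top` itself. [cite: MochizukiAbsTopIII2015, Corollary 2.4 (c) p.55] -/
theorem hyperbolicCorePresentation_U :
    (hyperbolicCorePresentation X Ucov p hX hp hs hd hU G hG hna).U = Ucov := rfl

/-- The presenting group of `[𝕌/Π]` is the commensurator `Π`. [cite: MochizukiAbsTopIII2015, Corollary 2.4 (c) p.55] -/
theorem hyperbolicCorePresentation_Γ :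
    (hyperbolicCorePresentation X Ucov p hX hp hs hd hU G hG hna).Γ = coreGroup p G := rfl

/-- `Π` acts on `U^top` tautologically (`γ • x = γ x`). [cite: MochizukiAbsTopIII2015, Corollary 2.4 (c) p.55] -/
theorem hyperbolicCorePresentation_smul (γ : coreGroup p G) (x : Ucov) :
    @HSMul.hSMul (coreGroup p G) Ucov Ucov
        (@instHSMul _ _ (hyperbolicCorePresentation X Ucov p hX hp hs hd hU G hG hna).act.toSMul) γ x =
      (γ : Ucov ≃ₜ Ucov) x := rfl

/-- «equipping this quotient with the [pre-]Aut-holomorphic structure … determined by restricting the Aut-holomorphic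
structure of `𝕌`»: the Aut-holomorphic structure of the presentation is that of `𝕌`.
[cite: MochizukiAbsTopIII2015, Corollary 2.4 (c) p.55] -/
theorem hyperbolicCorePresentation_str :
    (hyperbolicCorePresentation X Ucov p hX hp hs hd hU G hG hna).str = AutHolStructure.ofCharted Ucov := rfl

/-- A subgroup lies in its own commensurator (conjugation by an element of `H` fixes `H`; used for «the image of
`π₁(X^top)` in its commensurator `Π`»). [cite: MochizukiAbsTopIII2015, Corollary 2.4 (c) p.54] -/
private theorem le_commensurator_self {A : Type*} [Group A] (H : Subgroup A) :
    H ≤ Subgroup.Commensurable.commensurator H := by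
  intro h hh
  rw [Subgroup.Commensurable.commensurator_mem_iff]
  have : ConjAct.toConjAct h • H = H := by
    ext x
    rw [Subgroup.mem_pointwise_smul_iff_inv_smul_mem, ← ConjAct.toConjAct_inv,
      ConjAct.toConjAct_smul, inv_inv]
    constructor
    · intro hx
      have := H.mul_mem (H.mul_mem hh hx) (H.inv_mem hh)
      simpa only [mul_assoc, mul_inv_cancel, mul_one, mul_inv_cancel_left] using this
    · intro hx
      exact H.mul_mem (H.mul_mem (H.inv_mem hh) hx) hh
  rw [this]

omit [TopologicalSpace X] [T2Space X] [ChartedSpace ℂ X] [IsManifold 𝓘(ℂ, ℂ) ω X] [T2Space Ucov]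
  [SimplyConnectedSpace Ucov] [ChartedSpace ℂ Ucov] [IsManifold 𝓘(ℂ, ℂ) ω Ucov] in
include hna in
/-- The deck group `π₁(X^top) = Aut(U^top/X^top)` is a subgroup of `Π` (so `𝕏 = [𝕌/π₁(X^top)] → [𝕌/Π] = ℍ` is a
morphism of presentations with the identity on `U^top`). [cite: MochizukiAbsTopIII2015, Corollary 2.4 (c) p.55] -/
theorem deckGroup_le_coreGroup : deckGroup p ≤ coreGroup p G := by
  intro γ hγ
  have hγG : γ ∈ G := hna.1 hγ
  refine Subgroup.mem_map.mpr ⟨⟨γ, hγG⟩, ?_, rfl⟩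
  exact le_commensurator_self _ (Subgroup.mem_subgroupOf.mpr hγ)

end Presentation

end Literature.AnabelianGeometry.AbsoluteAnabelian

end
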